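import Summits.HubbardSuperconductivity.HubbardSuperconductivity.Theses.ThermalWedge
import Summits.HubbardSuperconductivity.HubbardSuperconductivity.Theorems.ThermalWedgeTwSourcedInertnessCorrections
import Summits.HubbardSuperconductivity.HubbardSuperconductivity.Theorems.ThermalWedgeTwSourcedInertnessZeroSourceResponse
import Literature.MathematicalPhysics.QuantumLattice.ComplexSourceCumulantBound

/-!
# Crux `TwSourcedInertness` (item `stmt-HubbardSuperconductivity-1696`): the thermal-disc stub from
ZERO-SOURCE pair-field cumulant bounds

`--supports stmt-HubbardSuperconductivity-1696`; no definition is introduced.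

The registered stub `stub_discCorrection` of the line `temperature-for-source-exchange`
(Cruxes/TwSourcedInertness/Lines/temperature_for_source_exchange.lean) asks for the interaction
correction to the sourced pressure gain on the thermal disc `|h| ≤ c/β`. This file reduces it — and,
with the heat-chord correction `stub_thermalCorrection`, the whole crux — to a statement about the
INTERACTING TORUS AT ZERO SOURCE ONLY:

**(K) pair-field cumulant bounds.** For `[μ₁,μ₂] ⊂ (-4,0)` there are `U₀, a, A, B > 0` such that for
`0 < U ≤ U₀`, `1 ≤ β ≤ e^{a/U}`, `μ ∈ [μ₁,μ₂]`, eventually in `L`, the Taylor coefficients at `h = 0` of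
`log Z_L(h)`, `Z_L(h) = tr e^{-β(H_L - h(Δ_d + Δ_d†))}`, `H_L = hubbardTorusWith 2 L 1 U μ`, obey

  `‖(m!)⁻¹ (log Z_L)⁽ᵐ⁾(0)‖ ≤ A(1 + log β) · βL² · (Bβ)ᵐ⁻²`   (`m ≥ 2`).

`m!⁻¹(log Z_L)⁽ᵐ⁾(0)` is `1/m!` times the `m`-th imaginary-time-ordered cumulant of the macroscopic
`d`-wave pair field `∫₀^β (Δ_d + Δ_d†)(τ)dτ` in the zero-source Gibbs state — the zero-frequency,
`d`-wave–smeared `2m`-leg kernel of the effective potential; (K) is its dimensional size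
(`βL² · β^{m-2}`, with the Cooper logarithm at `m = 2`), i.e. the natural all-order output of a
Benfatto–Giuliani–Mastropietro-type multiscale analysis of the UNSOURCED model (free case: one
fermion loop with `m` insertions, `∫dξ ρ(ξ) β⁻¹Σ_{k₀}(k₀²+ξ²)^{-m/2} ≍ ρ β^{m-2}`, `ρ log β` at `m = 2`).

* `twThermalDisc_of_pairCumulantBound` — **(K) ⇒ the interacting thermal-disc bound**
  `p̃_U(h) - p̃_U(0) ≤ 2A(1 + log β)h²` for `|h| ≤ 1/(2Bβ)` (Literature
  `dWaveSource_sourcedGain_le_of_taylor_bound`: the cumulant bound continues `log Z_L` analytically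
  to the complex source disc `‖h‖ < 1/(Bβ)` — which is therefore ZERO-FREE — and bounds it there;
  no sourced expansion, no Nambu propagator, no control at complex source is presupposed);
* `free_sourcedGain_nonneg` — the free sourced gain is `≥ 0` (Peierls–Bogoliubov at `⟨Δ_d+Δ_d†⟩ = 0`);
* `stub_discCorrection_of_pairCumulantBound` — **(K) ⇒ `stub_discCorrection`** verbatim
  (subtract the non-negative free gain);
* `twSourcedInertness_of_pairCumulantBound` — **(K) ∧ `stub_thermalCorrection` ⇒
  `TwSourcedInertness`** (`twSourcedInertness_of_corrections`).

So the sourced crux needs the zero-source engine's kernel bounds at all orders (smeared with the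
`d`-wave form factor), plus the zero-source heat-chord law — and nothing at nonzero source.

Sources: D. Ruelle, *Statistical Mechanics* (1969) §4.4 (pressure analyticity from zero-freeness);
G. Benfatto, A. Giuliani, V. Mastropietro, Ann. Henri Poincaré 7 (2006) 809, Thm 2.1/§3 (the kernel
bounds (K) is modelled on; NOT asserted here).
-/

noncomputable section

namespace Summit.HubbardSuperconductivity.HubbardSuperconductivity.Theorems

open scoped Nat
open Matrix Finset Literature.MathematicalPhysics.QuantumLattice Literature.Probability.LatticeModels
open Summit.HubbardSuperconductivity.HubbardSuperconductivity.Theses.ThermalWedge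

/-- **(K) ⇒ the interacting thermal-disc bound.** If the zero-source pair-field cumulants of the
interacting torus obey `‖(m!)⁻¹(log Z_L)⁽ᵐ⁾(0)‖ ≤ A(1+log β)βL²(Bβ)ᵐ⁻²` (`m ≥ 2`) in the regime
`0 < U ≤ U₀`, `1 ≤ β ≤ e^{a/U}`, `μ ∈ [μ₁,μ₂]`, eventually in `L`, then on the thermal disc
`|h| ≤ 1/(2Bβ)` the sourced pressure gain is `≤ 2A(1 + log β)h²`. [cite: Ruelle1969, §4.4] -/
theorem twThermalDisc_of_pairCumulantBound
    (hK : ∀ μ₁ μ₂ : ℝ, -4 < μ₁ → μ₁ ≤ μ₂ → μ₂ < 0 → ∃ U₀ a A B : ℝ, 0 < U₀ ∧ 0 < a ∧ 0 < A ∧ 0 < B ∧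
      ∀ U : ℝ, 0 < U → U ≤ U₀ → ∀ β : ℝ, 1 ≤ β → β ≤ Real.exp (a / U) → ∀ μ ∈ Set.Icc μ₁ μ₂,
      ∃ L₀ : ℕ, ∀ (L : ℕ) [NeZero L], L₀ ≤ L → ∀ m : ℕ, 2 ≤ m →
      ‖((m ! : ℂ))⁻¹ * iteratedDeriv m (fun z : ℂ => Complex.log (Matrix.partitionFn β
          (Literature.MathematicalPhysics.QuantumLattice.hubbardTorusWith 2 L 1 U μ -
            z • (pairField dWaveFormFactor L + (pairField dWaveFormFactor L)ᴴ)))) 0‖ ≤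
        A * (1 + Real.log β) * (β * (L : ℝ) ^ 2) * (B * β) ^ (m - 2)) :
    ∀ μ₁ μ₂ : ℝ, -4 < μ₁ → μ₁ ≤ μ₂ → μ₂ < 0 → ∃ U₀ a C c : ℝ, 0 < U₀ ∧ 0 < a ∧ 0 < C ∧ 0 < c ∧
      ∀ U : ℝ, 0 < U → U ≤ U₀ → ∀ β : ℝ, 1 ≤ β → β ≤ Real.exp (a / U) → ∀ μ ∈ Set.Icc μ₁ μ₂,
      ∃ L₀ : ℕ, ∀ (L : ℕ) [NeZero L], L₀ ≤ L → ∀ h : ℝ, |h| ≤ c / β →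
      Real.log (Matrix.partitionFn β (Literature.MathematicalPhysics.QuantumLattice.dWaveSourceTorus L U μ h)).re / (β * (L : ℝ) ^ 2) -
        Real.log (Matrix.partitionFn β (Literature.MathematicalPhysics.QuantumLattice.dWaveSourceTorus L U μ 0)).re / (β * (L : ℝ) ^ 2) ≤
      C * (1 + Real.log β) * h ^ 2 := by
  intro μ₁ μ₂ h4 h12 h0
  obtain ⟨U₀, a, A, B, hU₀, ha, hA, hB, hreg⟩ := hK μ₁ μ₂ h4 h12 h0
  refine ⟨U₀, a, 2 * A, 1 / (2 * B), hU₀, ha, by positivity, by positivity, ?_⟩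
  intro U hU hUle β hβ1 hβa μ hμ
  obtain ⟨L₀, hL₀⟩ := hreg U hU hUle β hβ1 hβa μ hμ
  refine ⟨L₀, fun L _ hL h hh => ?_⟩
  have hβ : 0 < β := by linarith
  have hlog : 0 ≤ 1 + Real.log β := by
    have := Real.log_nonneg hβ1
    linarith
  have hL2 : (0 : ℝ) < (L : ℝ) ^ 2 := by
    have : (0 : ℝ) < L := Nat.cast_pos.2 (Nat.pos_of_ne_zero (NeZero.ne L))
    positivity
  have hβL : 0 < β * (L : ℝ) ^ 2 := mul_pos hβ hL2
  -- the cumulant bound at this `(β, L)` with constants `A' = A(1+log β)βL²`, `B' = Bβ`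
  have hA' : 0 ≤ A * (1 + Real.log β) * (β * (L : ℝ) ^ 2) := by positivity
  have hB' : 0 ≤ B * β := by positivity
  have hs : B * β * |h| ≤ 1 / 2 := by
    rw [le_div_iff₀ hβ] at hh
    have : B * β * |h| = B * (|h| * β) := by ring
    rw [this]
    calc B * (|h| * β) ≤ B * (1 / (2 * B)) := mul_le_mul_of_nonneg_left hh hB.le
      _ = 1 / 2 := by field_simp
  have key := dWaveSource_sourcedGain_le_of_taylor_bound L hβ U μ hA' hB' (hL₀ L hL) hs
  refine key.trans (le_of_eq ?_)
  rw [div_eq_iff hβL.ne']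
  ring

/-- **The free sourced gain is non-negative**: `0 ≤ p̃_0(h) - p̃_0(0)` on the torus (`β > 0`), by
Peierls–Bogoliubov at `H_L` towards `H_L - h(Δ_d + Δ_d†)` and `⟨Δ_d + Δ_d†⟩_{β,H_L} = 0` (gauge
symmetry). (The same holds at every `U`; only `U = 0` is used below.) [folklore] -/
theorem free_sourcedGain_nonneg (L : ℕ) [NeZero L] {β : ℝ} (hβ : 0 < β) (U μ h : ℝ) :
    0 ≤ Real.log (Matrix.partitionFn β (Literature.MathematicalPhysics.QuantumLattice.dWaveSourceTorus L U μ h)).re / (β * (L : ℝ) ^ 2) -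
        Real.log (Matrix.partitionFn β (Literature.MathematicalPhysics.QuantumLattice.dWaveSourceTorus L U μ 0)).re / (β * (L : ℝ) ^ 2) := by
  set H := hubbardTorusWith 2 L 1 U μ with hH
  set Q := pairField dWaveFormFactor L + (pairField dWaveFormFactor L)ᴴ with hQ
  have hHh : H.IsHermitian := isHermitian_hamiltonianWith (fermionTorusGraph 2 L) 1 U μ
  have hQh : Q.IsHermitian := isHermitian_pairField_add_conjTranspose L
  have h0 : dWaveSourceTorus L U μ 0 = H := dWaveSourceTorus_zero L U μ
  have hs' : dWaveSourceTorus L U μ h = H - (h : ℂ) • Q := rfl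
  have hPB := twNec_mul_re_gibbsState_source_le_gain_sub hHh hQh β 0 h
  have hgs : gibbsState β H Q = 0 := gibbsState_pairSource_eq_zero L hβ.ne' U μ
  simp only [Complex.ofReal_zero, zero_smul, sub_zero, zero_add, hgs, Complex.zero_re, mul_zero]
    at hPB
  rw [h0, hs', ← sub_div]
  have hL2 : (0 : ℝ) < (L : ℝ) ^ 2 := by
    have : (0 : ℝ) < L := Nat.cast_pos.2 (Nat.pos_of_ne_zero (NeZero.ne L))
    positivity
  exact div_nonneg hPB (mul_pos hβ hL2).le

/-- **(K) ⇒ the registered stub `stub_discCorrection`** (verbatim signature of the skeleton of line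
`temperature-for-source-exchange`): subtract the non-negative free gain from the interacting
thermal-disc bound. [cite: Ruelle1969, §4.4] -/
theorem stub_discCorrection_of_pairCumulantBound :
    (∀ μ₁ μ₂ : ℝ, -4 < μ₁ → μ₁ ≤ μ₂ → μ₂ < 0 → ∃ U₀ a A B : ℝ, 0 < U₀ ∧ 0 < a ∧ 0 < A ∧ 0 < B ∧ ∀ U : ℝ, 0 < U → U ≤ U₀ → ∀ β : ℝ, 1 ≤ β → β ≤ Real.exp (a / U) → ∀ μ ∈ Set.Icc μ₁ μ₂, ∃ L₀ : ℕ, ∀ (L : ℕ) [NeZero L], L₀ ≤ L → ∀ m : ℕ, 2 ≤ m → ‖((Nat.factorial m : ℂ))⁻¹ * iteratedDeriv m (fun z : ℂ => Complex.log (Matrix.partitionFn β (Literature.MathematicalPhysics.QuantumLattice.hubbardTorusWith 2 L 1 U μ - z • (Literature.MathematicalPhysics.QuantumLattice.pairField Literature.MathematicalPhysics.QuantumLattice.dWaveFormFactor L + (Literature.MathematicalPhysics.QuantumLattice.pairField Literature.MathematicalPhysics.QuantumLattice.dWaveFormFactor L)ᴴ)))) 0‖ ≤ A * (1 + Real.log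 β) * (β * (L : ℝ) ^ 2) * (B * β) ^ (m - 2)) →
    ∀ μ₁ μ₂ : ℝ, -4 < μ₁ → μ₁ ≤ μ₂ → μ₂ < 0 → ∃ U₀ a C c : ℝ, 0 < U₀ ∧ 0 < a ∧ 0 < C ∧ 0 < c ∧ ∀ U : ℝ, 0 < U → U ≤ U₀ → ∀ β : ℝ, 1 ≤ β → β ≤ Real.exp (a / U) → ∀ μ ∈ Set.Icc μ₁ μ₂, ∃ L₀ : ℕ, ∀ (L : ℕ) [NeZero L], L₀ ≤ L → ∀ h : ℝ, |h| ≤ c / β → (Real.log (Matrix.partitionFn β (Literature.MathematicalPhysics.QuantumLattice.dWaveSourceTorus L U μ h)).re / (β * (L : ℝ) ^ 2) - Real.log (Matrix.partitionFn β (Literature.MathematicalPhysics.QuantumLattice.dWaveSourceTorus L 0 μ h)).re / (β * (L : ℝ) ^ 2)) - (Real.log (Matrix.partitionFn β (Literature.MathematicalPhysics.QuantumLattice.dWaveSourceTorus L U μ 0)).re / (β * (L : ℝ) ^ 2) - Real.log (Matrix.partitionFn β (Literature.MathematicalPhysics.QuantumLattice.dWaveSourceTorus L 0 μ 0)).re /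 (β * (L : ℝ) ^ 2)) ≤ C * (1 + Real.log β) * h ^ 2 := by
  intro hK μ₁ μ₂ h4 h12 h0
  obtain ⟨U₀, a, C, c, hU₀, ha, hC, hc, hreg⟩ := twThermalDisc_of_pairCumulantBound hK μ₁ μ₂ h4 h12 h0
  refine ⟨U₀, a, C, c, hU₀, ha, hC, hc, ?_⟩
  intro U hU hUle β hβ1 hβa μ hμ
  obtain ⟨L₀, hL₀⟩ := hreg U hU hUle β hβ1 hβa μ hμ
  refine ⟨L₀, fun L _ hL h hh => ?_⟩
  have h1 := hL₀ L hL h hh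
  have hβ : 0 < β := by linarith
  have h2 := free_sourcedGain_nonneg L hβ 0 μ h
  linarith

/-- **(K) ∧ `stub_thermalCorrection` ⇒ `TwSourcedInertness`.** The crux follows from the zero-source
pair-field cumulant bounds (K) of the interacting torus together with the interaction correction to
the dyadic heat chord (the second registered stub of the line), via the lead's composition
`twSourcedInertness_of_corrections`. [cite: Ruelle1969, §4.4] -/
theorem twSourcedInertness_of_pairCumulantBound
    (hK : ∀ μ₁ μ₂ : ℝ, -4 < μ₁ → μ₁ ≤ μ₂ → μ₂ < 0 → ∃ U₀ a A B : ℝ, 0 < U₀ ∧ 0 < a ∧ 0 < A ∧ 0 < B ∧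
      ∀ U : ℝ, 0 < U → U ≤ U₀ → ∀ β : ℝ, 1 ≤ β → β ≤ Real.exp (a / U) → ∀ μ ∈ Set.Icc μ₁ μ₂,
      ∃ L₀ : ℕ, ∀ (L : ℕ) [NeZero L], L₀ ≤ L → ∀ m : ℕ, 2 ≤ m →
      ‖((m ! : ℂ))⁻¹ * iteratedDeriv m (fun z : ℂ => Complex.log (Matrix.partitionFn β
          (Literature.MathematicalPhysics.QuantumLattice.hubbardTorusWith 2 L 1 U μ -
            z • (pairField dWaveFormFactor L + (pairField dWaveFormFactor L)ᴴ)))) 0‖ ≤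
        A * (1 + Real.log β) * (β * (L : ℝ) ^ 2) * (B * β) ^ (m - 2))
    (hT : ∀ μ₁ μ₂ : ℝ, -4 < μ₁ → μ₁ ≤ μ₂ → μ₂ < 0 → ∃ U₀ a C : ℝ, 0 < U₀ ∧ 0 < a ∧ 0 < C ∧
      ∀ U : ℝ, 0 < U → U ≤ U₀ → ∀ β : ℝ, 2 ≤ β → β ≤ Real.exp (a / U) → ∀ μ ∈ Set.Icc μ₁ μ₂,
      ∃ L₀ : ℕ, ∀ (L : ℕ) [NeZero L], L₀ ≤ L →
      (Real.log (Matrix.partitionFn (β / 2) (Literature.MathematicalPhysics.QuantumLattice.hubbardTorusWith 2 L 1 U μ)).re / (β / 2 * (L : ℝ) ^ 2) -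
        Real.log (Matrix.partitionFn β (Literature.MathematicalPhysics.QuantumLattice.hubbardTorusWith 2 L 1 U μ)).re / (β * (L : ℝ) ^ 2)) -
      (Real.log (Matrix.partitionFn (β / 2) (Literature.MathematicalPhysics.QuantumLattice.hubbardTorusWith 2 L 1 0 μ)).re / (β / 2 * (L : ℝ) ^ 2) -
        Real.log (Matrix.partitionFn β (Literature.MathematicalPhysics.QuantumLattice.hubbardTorusWith 2 L 1 0 μ)).re / (β * (L : ℝ) ^ 2)) ≤
      C * (1 + Real.log β) / β ^ 2) :
    TwSourcedInertness :=
  twSourcedInertness_of_corrections (stub_discCorrection_of_pairCumulantBound hK) hT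

end Summit.HubbardSuperconductivity.HubbardSuperconductivity.Theorems
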